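import Literature.MathematicalPhysics.QuantumFieldTheory.Balaban1983to89.Node00.CarriersB13DecoratedTower
import Literature.MathematicalPhysics.QuantumFieldTheory.Balaban1983to89.B13EntrywiseBlockRungWitness

/-!
# NODE 00 (YM-PLAN Track A) — STAGE 3′(X.B13): A NON-DEGENERATE INHABITANT OF THE DECORATED TOWER, WITH THE RUNG
# (`ResidB13.blockDecorated`: over ANY g0 layer, on ANY site torus carrying a far `d₁`-collinear triple, the decorated datum whose object data ARE
# n10-w2's damped entrywise model `Δ₀ = fluctR`, `J = deco`, `C = 1`; S6's `toC.KK` IS its conditioned operator `condOpR` by `rfl`, and S5's rung face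
# `TermWalksRef` FIRES at `toC.toK` at the admissible package `nodeAPackage`)

COMPANION MODULE of `Node00/CarriersB13DecoratedTower` (storey S6, p584488) and `Node00/CarriersB13CondTowerWitness` (S5's inhabitant, p586416; seat
`pub-ymgap-dag-n10-w3` g0, director-ym LINE №197 ∕ HUMAN RULING D-0149): the A6 inhabitant (director №189 standing rule) of the NODE-A block of a junction
edition AT THE DECORATED TOWER (n10-c's announced module 65).  APPEND-ONLY DISCIPLINE: a NEW importing module; S5 ∕ S6, n10-w2's W-WAVE files (B)
`B13EntrywiseBlockWitness` (p583593) and (B′) `B13EntrywiseBlockRungWitness` (p586283), n10-c's `B13EntrywiseWalks` (module 31) are untouched and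
CONSUMED BY NAME — the model objects `loc2 ∕ fluctR ∕ deco ∕ condOpR ∕ nodeAPackage` and their letters are n10-w2's, never retyped here.
[Balaban1988RG2Cluster] = T. Bałaban, *Renormalization group approach to lattice gauge field theories. II. Cluster expansions*, Commun. Math. Phys.
**116** (1988) 1–22, p. 3 (after (1.7)), (1.11) p. 5, (2.5)–(2.8) pp. 12–14, p. 15, (2.16) p. 16; [13] = [Balaban1985BackgroundPropagators] (3.93)
p. 410, Thm 3.10 (3.107)–(3.108) p. 416, Thm 3.12 p. 423.

WHAT (MODEL — honesty ∕ non-vacuity only).  Data: a g0 layer `lam : ResidB13 θ`, a site torus `UT Nf`, a cube index `□₀`, a mass `M > 0`, a dimension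
bound `d_m ≥ ν`, a configuration size `α ≥ 0`, and a `d₁`-COLLINEAR TRIPLE `x₀ z x₁` with gaps `≥ R_σ := (nodeAPackage d_m κ₁ M α).Rσ` (κ₁ = the layer's);
(B′) `exists_collinear_triple_circle` supplies such triples on every circle `ℤ∕nℤ`, `n ≥ 4⌈R_σ⌉`.  The decorated datum `ResidB13.blockDecorated …` has per
term `Λ = C₀ := Unit` (the bond and its copy), `P := Unit ⊕ Unit`, `locF = locN := loc2 x₀ x₁`, **`Δ₀ := fluctR M R t`** (R = the package's radius, `t =
e^{−7d₁(x₀,x₁)}`: the damped bond–copy configuration entry — NOT symmetric, u-dependent), **`J := deco x₀ x₁ z □₀`** (the one-cube geodesic decoration: the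
bond–copy pairs CARRY `□₀`), `Cm := 1`, real reference `K₀ := diag M` (`hK₀` by (B′) `condOpR_zero_zero`, PD), `X := {z}`, `Y0l = Pl := ∅`, `uOf := 0`, `r := 1`.

WHAT IS PROVED (0 sorry).  §1 `ResidB13.blockDecorated` and faces: ★ `blockDecorated_toC_KK` — S6's operator of record `toC.KK Z t = decoratedOp (fluctR …)
(deco …) 1` IS (B′)'s `condOpR x₀ x₁ z □₀ M R t` (**`rfl`**: the two displays agree token for token), `blockDecorated_frame` (`rfl`), `_X`, `_Δ₀ ∕ _J ∕ _Cm ∕ _locF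
∕ _locN` (`rfl`), `_J_decorated` (a decorated pair), `_Δ₀_not_symm`, `_Y0l_inter_Pl` (= ∅: S4's lever does not fire), `_KK_inl_inr` (the conditioned bond–copy
entry is `σ(□₀)·(t∕R)·u∕2` — genuine σ- AND u-dependence).  §2 ★★ **`termWalksRef_blockDecorated`**: `TermWalksRef ((lam.blockDecorated …).toC.toK.𝒦 Z t)
(nodeAPackage d_m κ₁ M α)` for EVERY term whenever `0 ≤ κ₁` — module 32's own derivation (`B13EntrywiseWalks.structuredExpansion_sandwich_rawEntrywise` +
`JointWalkExpansion.mono`) run at the RECORD's fields with (B′)'s letters (`rawEntryLetters_fluctR`, `fiber_loc2_le_one`, `geodesicDecoration_deco`,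
`abs_one_apply_le`, `one_apply_range`, `kbarModel_le_kbarNodeA`, `condOpR_accretive`, `far_loc2`), closed by S5's `termWalksRef_toK_at`;
`exists_residB13D_termWalksRef` (the ∃-form over any g0 layer and any admissible triple) and `exists_residB13D_termWalksRef_circle` (closed instance on `ℤ∕nℤ`).

HONEST FRAMING: a finite-matrix MODEL certifying that S6's decorated datum, S6's identity `hKK := rfl` and S5's rung face are JOINTLY inhabited by a genuine
(non-symmetric, u-dependent) `Δ₀` and a genuinely decorated `J` — and NOTHING ELSE: whether Bałaban's `Δ_k ∕ G_k(U) ∕ Q_k ∕ C` produce such letters with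
k-uniform constants is NODE A ([13] Thms 3.10 ∕ 3.12; N06 s4 ∕ (D4); NODE 00's reading (R)); the Lemma 1–2 located inputs, the (2.24)–(2.26) numerics (n10-w1)
and the exchange thresholds (n10-w2's (B″)) have their own owners.  Count-neutral; N10 NOT discharged; K1⁷ NOT closed; counts of record unmoved; one finite 𝕋⁴
programme at fixed ε, Bałaban AS PRINTED — the Yang–Mills mass gap (Clay) is NOT proved by any of this; R4 closes the conditional finite-𝕋⁴ rung
`BalabanLadder.UV` only; nothing continuum ∕ ℝ⁴ ∕ OS.  No `sorry`, no `axiom`, no `instance` declaration, no `notation`.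
-/

noncomputable section

namespace Literature.MathematicalPhysics.QuantumFieldTheory.Balaban1983to89.Node00

open scoped Matrix
open Literature.MathematicalPhysics.QuantumFieldTheory.Balaban1983to89.TreeLengthTorus (TDom TPt)
open Literature.MathematicalPhysics.QuantumFieldTheory.Balaban1983to89.B5TorusCover (UT)
open Literature.MathematicalPhysics.QuantumFieldTheory.Balaban1983to89.B9Thm37GlueTorus (tdist1)
open Literature.MathematicalPhysics.QuantumFieldTheory.Balaban1983to89.NodeOLettersOfWalksPerturbative (RefPackage TermWalksRef)
open Literature.MathematicalPhysics.QuantumFieldTheory.Balaban1983to89.B13JointWalkExpansion (JointWalkExpansion)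
open Literature.MathematicalPhysics.QuantumFieldTheory.Balaban1983to89.B13EntrywiseWalks (structuredExpansion_sandwich_rawEntrywise)
open Literature.MathematicalPhysics.QuantumFieldTheory.Balaban1983to89.B13EntrywiseBlockWitness
  (loc2 deco deco_inl_inr geodesicDecoration_deco ne_of_collinear fiber_loc2_le_one abs_one_apply_le one_apply_range far_loc2 kbarModel)
open Literature.MathematicalPhysics.QuantumFieldTheory.Balaban1983to89.B13EntrywiseBlockRungWitness
  (fluctR condOpR nodeAPackage kbarNodeA tNodeA rawEntryLetters_fluctR fluctR_not_symm condOpR_zero_zero condOpR_accretive condOpR_inl_inr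
    nodeAPackage_fields admissible_nodeAPackage kbarModel_le_kbarNodeA tNodeA_pos exists_collinear_triple_circle)

section Block

variable {θ : Stage3Params}
variable {ν : ℕ} (Nf : Fin ν → ℕ) [∀ i, NeZero (Nf i)]

/-! ## §1. The decorated datum of the damped entrywise model over a g0 layer -/

/-- (B′)'s reference point in the shape of a real DIAGONAL reference value: `condOpR … 0 0 = (diag M) ↪ ℂ`.
[cite: Balaban1988RG2Cluster, p.15 («For the pair (U, 0) the operators are symmetric»)] -/
theorem condOpR_zero_zero_diagonal {n₁ : ℕ} (cube : TPt 4 n₁) {x₀ z x₁ : UT Nf} {M R t Rσ : ℝ} (hRσ : 0 < Rσ)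
    (h0 : Rσ ≤ tdist1 Nf x₀ z) (h1 : Rσ ≤ tdist1 Nf x₁ z) (hcol : tdist1 Nf x₀ z + tdist1 Nf z x₁ ≤ tdist1 Nf x₀ x₁) :
    condOpR x₀ x₁ z cube M R t 0 0 = (Matrix.diagonal fun _ : Unit ⊕ Unit => M).map (algebraMap ℝ ℂ) := by
  rw [condOpR_zero_zero cube hRσ h0 h1 hcol, Matrix.smul_one_eq_diagonal, Matrix.diagonal_map (map_zero _)]
  rfl

/-- MODEL. **THE DECORATED DATUM OF n10-w2's DAMPED ENTRYWISE MODEL over a g0 layer** (data: the layer, the site torus, a cube index `□₀`, a mass `M > 0`,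
a dimension bound `d_m`, a configuration size `α`, and a `d₁`-collinear triple `x₀ z x₁` with gaps `≥ (nodeAPackage d_m κ₁ M α).Rσ`): per term the bond
and its copy (`Λ = C₀ := Unit`), fine bonds `P := Unit ⊕ Unit` located by `loc2 x₀ x₁`, fluctuation operator `fluctR M R e^{−7d₁(x₀,x₁)}` (`R` = the
package's radius), decoration `deco x₀ x₁ z □₀`, averaging operator `1`, reference `diag M`, σ-region `{z}`, no χ-bonds, `uOf := 0`, `r := 1`.
[cite: Balaban1988RG2Cluster, (2.5)–(2.8) pp.12–14, p.15, (1.11) p.5; Balaban1985BackgroundPropagators, Thm 3.10 (3.107) p.416] -/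
def ResidB13.blockDecorated (lam : ResidB13 θ) (cube : TPt 4 (lam.n + 1)) (x₀ z x₁ : UT Nf) {M : ℝ} (hM : 0 < M) (dm : ℕ) (α : ℝ)
    (h0 : (nodeAPackage dm lam.c.κ₁ M α).Rσ ≤ tdist1 Nf x₀ z) (h1 : (nodeAPackage dm lam.c.κ₁ M α).Rσ ≤ tdist1 Nf x₁ z)
    (hcol : tdist1 Nf x₀ z + tdist1 Nf z x₁ ≤ tdist1 Nf x₀ x₁) : ResidB13D θ :=
  (lam.withCond ν Nf ℂ (fun _ _ => Unit) (fun _ _ => Unit)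
      (fun _ _ => condOpR x₀ x₁ z cube M (nodeAPackage dm lam.c.κ₁ M α).R (Real.exp (-(7 * tdist1 Nf x₀ x₁))))
      (fun _ _ => Matrix.diagonal fun _ => M)
      (fun _ _ => condOpR_zero_zero_diagonal Nf cube (tNodeA_pos (dm := dm) (κ₁ := lam.c.κ₁) hM) h0 h1 hcol)
      (fun _ _ => Matrix.posDef_diagonal_iff.2 fun _ => hM)
      (fun _ _ => loc2 x₀ x₁) (fun _ _ => {z}) (fun _ _ => Fintype.card Unit)
      (fun _ _ _ => (Finset.card_filter_le _ _).trans Finset.card_univ.le)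
      (fun _ _ _ => 0) 1 (fun _ _ => ∅) (fun _ _ => ∅) (fun _ _ φ _ => φ)).withDecoration
    (fun _ _ => Unit ⊕ Unit) (fun _ _ => loc2 x₀ x₁)
    (fun _ _ => fluctR M (nodeAPackage dm lam.c.κ₁ M α).R (Real.exp (-(7 * tdist1 Nf x₀ x₁))))
    (fun _ _ => deco x₀ x₁ z cube) (fun _ _ => (1 : Matrix (Unit ⊕ Unit) (Unit ⊕ Unit) ℝ))
    (fun _ _ => condOpR_zero_zero_diagonal Nf cube (tNodeA_pos (dm := dm) (κ₁ := lam.c.κ₁) hM) h0 h1 hcol)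

variable (lam : ResidB13 θ) (cube : TPt 4 (lam.n + 1)) {x₀ z x₁ : UT Nf} {M : ℝ} (hM : 0 < M) (dm : ℕ) (α : ℝ)
  (h0 : (nodeAPackage dm lam.c.κ₁ M α).Rσ ≤ tdist1 Nf x₀ z) (h1 : (nodeAPackage dm lam.c.κ₁ M α).Rσ ≤ tdist1 Nf x₁ z)
  (hcol : tdist1 Nf x₀ z + tdist1 Nf z x₁ ≤ tdist1 Nf x₀ x₁)

/-- The frame is the given layer (`rfl`). [cite: Balaban1988RG2Cluster, (2.14) p.15 (bookkeeping)] -/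
theorem ResidB13.blockDecorated_frame :
    (lam.blockDecorated Nf cube x₀ z x₁ hM dm α h0 h1 hcol).toC.toK.frame = { lam with T₃ := fun _ _ _ => 0 } := rfl

/-- ★ **S6's OPERATOR OF RECORD IS (B′)'s CONDITIONED OPERATOR, BY `rfl`**: `toC.KK Z t = decoratedOp (fluctR …) (deco …) 1 = condOpR x₀ x₁ z □₀ M R t` —
the junction's `hKK` right-hand side as DEFINED in S6 and as TYPED by n10-w2 agree token for token. [cite: Balaban1988RG2Cluster, (2.5)–(2.8) pp.12–14, p.3] -/
theorem ResidB13.blockDecorated_toC_KK (Z : TDom 4 (lam.n + 1)) (t : B13TermIdx θ lam.n lam.m₃) :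
    (lam.blockDecorated Nf cube x₀ z x₁ hM dm α h0 h1 hcol).toC.KK Z t
      = condOpR x₀ x₁ z cube M (nodeAPackage dm lam.c.κ₁ M α).R (Real.exp (-(7 * tdist1 Nf x₀ x₁))) := rfl

/-- The fluctuation operator of every term is (B′)'s damped model (`rfl`). [cite: Balaban1985BackgroundPropagators, (3.107) p.416 (model)] -/
theorem ResidB13.blockDecorated_Δ₀ (Z : TDom 4 (lam.n + 1)) (t : B13TermIdx θ lam.n lam.m₃) :
    (lam.blockDecorated Nf cube x₀ z x₁ hM dm α h0 h1 hcol).Δ₀ Z t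
      = fluctR M (nodeAPackage dm lam.c.κ₁ M α).R (Real.exp (-(7 * tdist1 Nf x₀ x₁))) := rfl

/-- The decoration of every term is (B)'s one-cube geodesic decoration (`rfl`). [cite: Balaban1988RG2Cluster, (1.11) p.5 (model)] -/
theorem ResidB13.blockDecorated_J (Z : TDom 4 (lam.n + 1)) (t : B13TermIdx θ lam.n lam.m₃) :
    (lam.blockDecorated Nf cube x₀ z x₁ hM dm α h0 h1 hcol).J Z t = deco x₀ x₁ z cube := rfl

/-- The averaging operator of every term is `1` (`rfl`). [cite: Balaban1988RG2Cluster, (2.5) p.12 (model)] -/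
theorem ResidB13.blockDecorated_Cm (Z : TDom 4 (lam.n + 1)) (t : B13TermIdx θ lam.n lam.m₃) :
    (lam.blockDecorated Nf cube x₀ z x₁ hM dm α h0 h1 hcol).Cm Z t = (1 : Matrix (Unit ⊕ Unit) (Unit ⊕ Unit) ℝ) := rfl

/-- The fine bonds and the term's bonds are located by `loc2 x₀ x₁` (`rfl`). [cite: Balaban1985BackgroundPropagators, (3.93) p.410 (model)] -/
theorem ResidB13.blockDecorated_locF (Z : TDom 4 (lam.n + 1)) (t : B13TermIdx θ lam.n lam.m₃) :
    (lam.blockDecorated Nf cube x₀ z x₁ hM dm α h0 h1 hcol).locF Z t = loc2 x₀ x₁ ∧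
      (lam.blockDecorated Nf cube x₀ z x₁ hM dm α h0 h1 hcol).locN Z t = loc2 x₀ x₁ := ⟨rfl, rfl⟩

/-- The σ-region of every term is `{z}` (`rfl`), non-empty. [cite: Balaban1988RG2Cluster, p.13] -/
theorem ResidB13.blockDecorated_X (Z : TDom 4 (lam.n + 1)) (t : B13TermIdx θ lam.n lam.m₃) :
    (lam.blockDecorated Nf cube x₀ z x₁ hM dm α h0 h1 hcol).X Z t = {z} ∧ ((lam.blockDecorated Nf cube x₀ z x₁ hM dm α h0 h1 hcol).X Z t).Nonempty :=
  ⟨rfl, Finset.singleton_nonempty z⟩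

/-- **No χ-bond of either kind** (`Y0l ∩ Pl = ∅`): S4's relocated lever does NOT fire at this datum. [cite: Balaban1988RG2Cluster, (2.3) p.12] -/
theorem ResidB13.blockDecorated_Y0l_inter_Pl (Z : TDom 4 (lam.n + 1)) (t : B13TermIdx θ lam.n lam.m₃) :
    (lam.blockDecorated Nf cube x₀ z x₁ hM dm α h0 h1 hcol).Y0l Z t ∩ (lam.blockDecorated Nf cube x₀ z x₁ hM dm α h0 h1 hcol).Pl Z t = ∅ := rfl

/-- **GENUINENESS (decoration)**: the bond–copy pair IS decorated — `J (inl, inr) = {□₀}`. [cite: Balaban1988RG2Cluster, (1.11) p.5, p.3] -/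
theorem ResidB13.blockDecorated_J_decorated (Z : TDom 4 (lam.n + 1)) (t : B13TermIdx θ lam.n lam.m₃) :
    (lam.blockDecorated Nf cube x₀ z x₁ hM dm α h0 h1 hcol).J Z t (Sum.inl (), Sum.inr ()) = {cube} :=
  deco_inl_inr cube hcol () ()

/-- **GENUINENESS (fluctuation operator)**: `Δ₀(u)` is NOT symmetric off `u = 0`. [cite: Balaban1988RG2Cluster, p.15; Balaban1985BackgroundPropagators, (3.107) p.416] -/
theorem ResidB13.blockDecorated_Δ₀_not_symm (hα : 0 ≤ α) (Z : TDom 4 (lam.n + 1)) (t : B13TermIdx θ lam.n lam.m₃) {u : ℂ} (hu : u ≠ 0) :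
    (lam.blockDecorated Nf cube x₀ z x₁ hM dm α h0 h1 hcol).Δ₀ Z t u (Sum.inl ()) (Sum.inr ())
      ≠ (lam.blockDecorated Nf cube x₀ z x₁ hM dm α h0 h1 hcol).Δ₀ Z t u (Sum.inr ()) (Sum.inl ()) :=
  fluctR_not_symm (admissible_nodeAPackage (dm := dm) (κ₁ := lam.c.κ₁) hM hα).hR (Real.exp_pos _) hu

/-- **GENUINENESS (the conditioned operator)**: the bond–copy entry of `toC.KK` is `σ(□₀)·((t∕R)·u)∕2` — it moves with `σ` AND with `u`.
[cite: Balaban1988RG2Cluster, (2.5)–(2.8) pp.12–14, p.15] -/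
theorem ResidB13.blockDecorated_KK_inl_inr (Z : TDom 4 (lam.n + 1)) (t : B13TermIdx θ lam.n lam.m₃) (σ : TPt 4 (lam.n + 1) → ℂ) (u : ℂ) :
    (lam.blockDecorated Nf cube x₀ z x₁ hM dm α h0 h1 hcol).toC.KK Z t σ u (Sum.inl ()) (Sum.inr ())
      = σ cube * (((Real.exp (-(7 * tdist1 Nf x₀ x₁)) / (nodeAPackage dm lam.c.κ₁ M α).R : ℝ) : ℂ) * u / 2) :=
  condOpR_inl_inr cube hcol σ u () ()

/-! ## §2. The rung at the decorated datum -/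

/-- ★★ **S5's RUNG FACE FIRES AT THE DECORATED DATUM**: for every term `(Z, t)`, `TermWalksRef` of the kernels of record at n10-w2's admissible package
`nodeAPackage d_m κ₁ M α` (`κ₁ ≥ 0` the layer's; `ν ≤ d_m`).  PROOF = module 32's derivation at the record's own fields: ONE structured joint walk
expansion of `decoratedOp (fluctR …) (deco …) 1` from (B′)'s entrywise letters (`structuredExpansion_sandwich_rawEntrywise`), weakened to the package's
letters (`JointWalkExpansion.mono`, `kbarModel_le_kbarNodeA`), ONE positivity (`condOpR_accretive`), far-ness (`far_loc2`), multiplicity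
(`fiber_loc2_le_one`), then S5's `termWalksRef_toK_at`.  Stated with the record's own `C₀`-instances (as in `termWalksRef_hopCond`).
[cite: Balaban1988RG2Cluster, (2.5)–(2.8) pp.12–14, p.15, (2.16) p.16, (1.11) p.5; Balaban1985BackgroundPropagators, (3.93) p.410, Thm 3.10 (3.107)–(3.108) p.416, Thm 3.12 p.423] -/
theorem termWalksRef_blockDecorated (hκ₁ : 0 ≤ lam.c.κ₁) (hα : 0 ≤ α) (hν : ν ≤ dm) (Z : TDom 4 (lam.n + 1)) (t : B13TermIdx θ lam.n lam.m₃) :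
    @TermWalksRef _ _ _ _ _ _ _ _ _ ((lam.blockDecorated Nf cube x₀ z x₁ hM dm α h0 h1 hcol).toC.toK.𝒦 Z t)
      ((lam.blockDecorated Nf cube x₀ z x₁ hM dm α h0 h1 hcol).toC.toK.finC₀ Z t)
      ((lam.blockDecorated Nf cube x₀ z x₁ hM dm α h0 h1 hcol).toC.toK.decC₀ Z t) (nodeAPackage dm lam.c.κ₁ M α) := by
  obtain ⟨-, hεL, hκL, hKL, hεP, hκP, hKP, hm₀, hεA, hκA, hKA, hmA, -, hRσ, hnB, hdm⟩ := nodeAPackage_fields dm lam.c.κ₁ M α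
  have hrf : (nodeAPackage dm lam.c.κ₁ M α).Admissible := admissible_nodeAPackage (dm := dm) (κ₁ := lam.c.κ₁) hM hα
  have hT : 0 < tNodeA dm lam.c.κ₁ M := tNodeA_pos (dm := dm) (κ₁ := lam.c.κ₁) hM
  have hne : x₀ ≠ x₁ := ne_of_collinear hT (by rw [← hRσ]; exact h0) hcol
  -- (B′)'s entrywise letters of the record's fields
  have hEL := rawEntryLetters_fluctR (Nf := Nf) hM.le hrf.hR x₀ x₁
  -- module 32's derivation: ONE structured joint walk expansion of `decoratedOp (fluctR …) (deco …) 1` through `{z}`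
  obtain ⟨W', T', SX', A', D', ρ', J', T0', rev', hJ, -, -⟩ :=
    structuredExpansion_sandwich_rawEntrywise (d := 4) (N' := lam.n + 1) (c := ({ lam.c with L := θ.ℓ₆ + 1 } : B13.Consts))
      (locN := loc2 x₀ x₁) (X := ({z} : Finset (UT Nf))) (ε := 4) (kap := 3) (η := 1) hκ₁ (Finset.singleton_nonempty z) hEL
      (fun y => fiber_loc2_le_one hne y) (geodesicDecoration_deco cube x₀ x₁ z (M₁ := 2 * lam.c.κ₁ + 1) (by linarith)) one_pos
      (by norm_num) (by norm_num) (by show 2 * lam.c.κ₁ ≤ 1 * (2 * lam.c.κ₁ + 1); linarith) 1 (rC := 0) abs_one_apply_le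
      (fun k i h => one_apply_range k i h) (μ := 1) one_pos (by norm_num) (by norm_num) (by norm_num)
  -- the expansion constant is (B)'s `kbarModel ν κ₁ (M+1)`, dominated by the package's `K̄`
  have hKS0 : 0 ≤ ((1 : ℕ) * B6.c0 1 (1 : ℝ) ^ ν) * (((1 : ℕ) * B6.c0 1 (1 : ℝ) ^ ν) * Real.exp ((7 - 1) * (0 : ℝ)) *
      (Real.exp (({ lam.c with L := θ.ℓ₆ + 1 } : B13.Consts).κ₁ * (2 * 1 : ℕ)) * ((M + 1) * ((1 : ℕ) * (1 : ℕ) + 1))) * B6.c0 1 (1 : ℝ) ^ ν) *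
      Real.exp ((7 - 1 - 1) * (0 : ℝ)) * B6.c0 1 (1 : ℝ) ^ ν := by
    have hc : 0 ≤ B6.c0 1 (1 : ℝ) ^ ν := pow_nonneg (B6RandomWalk.c0_nonneg 1 1) ν
    positivity
  have hKP' : ((1 : ℕ) * B6.c0 1 (1 : ℝ) ^ ν) * (((1 : ℕ) * B6.c0 1 (1 : ℝ) ^ ν) * Real.exp ((7 - 1) * (0 : ℝ)) *
      (Real.exp (({ lam.c with L := θ.ℓ₆ + 1 } : B13.Consts).κ₁ * (2 * 1 : ℕ)) * ((M + 1) * ((1 : ℕ) * (1 : ℕ) + 1))) * B6.c0 1 (1 : ℝ) ^ ν) *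
      Real.exp ((7 - 1 - 1) * (0 : ℝ)) * B6.c0 1 (1 : ℝ) ^ ν ≤ (nodeAPackage dm lam.c.κ₁ M α).KbarP := by
    rw [hKP]
    exact (le_of_eq (by unfold kbarModel; rfl)).trans (kbarModel_le_kbarNodeA (κ₁ := lam.c.κ₁) hM.le hν)
  have hK := hJ.mono le_rfl (show (nodeAPackage dm lam.c.κ₁ M α).εP ≤ 4 - 1 - 1 - 1 by rw [hεP]; norm_num)
    (show (nodeAPackage dm lam.c.κ₁ M α).kapP ≤ 3 - 1 - 1 by rw [hκP]; norm_num) hKS0 hKP'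
  -- S5's rung face at the conditioned layer `toC`
  refine termWalksRef_toK_at (lam.blockDecorated Nf cube x₀ z x₁ hM dm α h0 h1 hcol).toC Z t (Finset.singleton_nonempty z)
    (nodeAPackage dm lam.c.κ₁ M α) hrf hK ?_ ?_ ?_ (show ν ≤ (nodeAPackage dm lam.c.κ₁ M α).dm by rw [hdm]; exact hν) (by rw [hεL, hεP]) (by rw [hκL, hκP]) (by rw [hKL, hKP]) (by rw [hεA, hεP]) (by rw [hκA, hκP])
    (by rw [hKA, hKP]) (by rw [hmA, hm₀])
  · intro v
    rw [hm₀]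
    exact condOpR_accretive cube hT (by rw [← hRσ]; exact h0) (by rw [← hRσ]; exact h1) hcol v
  · intro k
    exact far_loc2 (by rw [hRσ] at h0; rw [hRσ]; exact h0) (by rw [hRσ] at h1; rw [hRσ]; exact h1) k
  · intro x
    rw [hnB]
    exact fiber_loc2_le_one hne x

include Nf cube hM h0 h1 hcol in
/-- **∃-FORM — THE DECORATED TOWER IS INHABITED NON-DEGENERATELY, WITH THE RUNG**, over every g0 layer with `0 ≤ κ₁`, on every site torus carrying a
`d₁`-collinear triple with gaps `≥ (nodeAPackage d_m κ₁ M α).Rσ` (`ν ≤ d_m`): a decorated datum with the given frame, non-empty σ-regions, no χ-bond in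
`Y0l ∩ Pl`, a DECORATED pair, a NON-symmetric fluctuation operator, and `TermWalksRef` of every term at ONE admissible package.
[cite: Balaban1988RG2Cluster, (2.5)–(2.8) pp.12–14, p.15, (2.16) p.16; Balaban1985BackgroundPropagators, Thm 3.10 p.416, Thm 3.12 p.423] -/
theorem exists_residB13D_termWalksRef (hκ₁ : 0 ≤ lam.c.κ₁) (hα : 0 ≤ α) (hν : ν ≤ dm) :
    ∃ lamD : ResidB13D θ, ∃ rf : RefPackage, rf.Admissible ∧ lamD.toC.toK.frame = { lam with T₃ := fun _ _ _ => 0 } ∧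
      ∀ (Z : TDom 4 (lamD.n + 1)) (t : B13TermIdx θ lamD.n lamD.m₃),
        (lamD.X Z t).Nonempty ∧ lamD.Y0l Z t ∩ lamD.Pl Z t = ∅ ∧ (∃ ω, (lamD.J Z t ω).Nonempty) ∧
          (∃ u, lamD.Δ₀ Z t u ≠ (lamD.Δ₀ Z t u)ᵀ) ∧ TermWalksRef (lamD.toC.toK.𝒦 Z t) rf := by
  refine ⟨lam.blockDecorated Nf cube x₀ z x₁ hM dm α h0 h1 hcol, nodeAPackage dm lam.c.κ₁ M α,
    admissible_nodeAPackage (dm := dm) (κ₁ := lam.c.κ₁) hM hα, rfl, fun Z t => ⟨Finset.singleton_nonempty z, rfl,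
    ⟨(Sum.inl (), Sum.inr ()), ?_⟩, ⟨(1 : ℂ), fun h => ?_⟩, termWalksRef_blockDecorated Nf lam cube hM dm α h0 h1 hcol hκ₁ hα hν Z t⟩⟩
  · rw [lam.blockDecorated_J_decorated Nf cube hM dm α h0 h1 hcol]
    exact Finset.singleton_nonempty _
  · have h' := congrFun (congrFun h (Sum.inl ())) (Sum.inr ())
    rw [Matrix.transpose_apply] at h'
    exact lam.blockDecorated_Δ₀_not_symm Nf cube hM dm α h0 h1 hcol hα Z t one_ne_zero h'

end Block

/-! ## §3. The closed instance: the circle `ℤ∕nℤ` -/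

section Circle

variable {θ : Stage3Params}

/-- **THE DECORATED TOWER OVER ANY g0 LAYER IS INHABITED NON-DEGENERATELY ON EVERY LARGE CIRCLE** `ℤ∕nℤ` (`n ≥ 4⌈R_σ⌉`, `d_m ≥ 1`): (B′)'s
`exists_collinear_triple_circle` supplies the far collinear triple. [cite: Balaban1988RG2Cluster, (2.5)–(2.8) pp.12–14, p.15, (2.16) p.16; Balaban1984PropagatorsII, (2.46) p.231] -/
theorem exists_residB13D_termWalksRef_circle (lam : ResidB13 θ) (cube : TPt 4 (lam.n + 1)) (hκ₁ : 0 ≤ lam.c.κ₁) {M : ℝ} (hM : 0 < M)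
    {dm : ℕ} (hdm : 1 ≤ dm) {α : ℝ} (hα : 0 ≤ α) (n : ℕ) [NeZero n] (hn : 4 * ⌈(nodeAPackage dm lam.c.κ₁ M α).Rσ⌉₊ ≤ n) :
    ∃ lamD : ResidB13D θ, ∃ rf : RefPackage, rf.Admissible ∧ lamD.toC.toK.frame = { lam with T₃ := fun _ _ _ => 0 } ∧
      ∀ (Z : TDom 4 (lamD.n + 1)) (t : B13TermIdx θ lamD.n lamD.m₃),
        (lamD.X Z t).Nonempty ∧ lamD.Y0l Z t ∩ lamD.Pl Z t = ∅ ∧ (∃ ω, (lamD.J Z t ω).Nonempty) ∧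
          (∃ u, lamD.Δ₀ Z t u ≠ (lamD.Δ₀ Z t u)ᵀ) ∧ TermWalksRef (lamD.toC.toK.𝒦 Z t) rf := by
  obtain ⟨x₀, z, x₁, h0, h1, hcol⟩ :=
    exists_collinear_triple_circle (tNodeA_pos (dm := dm) (κ₁ := lam.c.κ₁) hM) n hn
  exact exists_residB13D_termWalksRef (fun _ : Fin 1 => n) lam cube hM dm α h0 h1 hcol hκ₁ hα hdm

end Circle

end Literature.MathematicalPhysics.QuantumFieldTheory.Balaban1983to89.Node00

end
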